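import Literature.NumberTheory.LFunctions.ZetaPartialSumZeroTotal
import Literature.NumberTheory.LFunctions.WeilLogLatticeComb
import Literature.NumberTheory.LFunctions.DivisorCombFactorisation
import Literature.NumberTheory.LFunctions.WeilExplicitProofs
import HarnessLib

/-!
# The zero side of the explicit formula for `ζ`-mollified resonator combs

Topic `Literature/NumberTheory/LFunctions`. For a finitely supported real resonator `α`
(`α_ℓ = 0` for `ℓ > L`), a Weil test function `b₁`, a length `M` and a width parameter
`1 ≤ κ ≤ M`, the **`ζ`-mollified resonator comb** is
`g(u) = ∑_{m ≤ LM} a_m b₁((u - log m) M/κ)`, `a_m = ∑_{k ∣ m, k ≤ M} α(m/k)/√k`, whose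
transform is `ĝ(s) = (κ/M) b̂₁(1/2 + (s-1/2)κ/M) Ã(s) ζ_M(1-s)`
(`Literature/NumberTheory/LFunctions/WeilLogLatticeComb.lean`,
`Literature/NumberTheory/LFunctions/DivisorCombFactorisation.lean`).  At a non-trivial zero `ρ`,
`(g ⋆ g̃)^(ρ) = ĝ(ρ) conj ĝ(1-ρ̄)` carries the product `ζ_M(1-ρ) ζ_M(ρ)` (up to conjugation),
and `Literature/NumberTheory/LFunctions/ZetaPartialSumZeroTotal.lean` bounds the resulting sum
over zeros:

* `Literature.NumberTheory.LFunctions.norm_weilMellin_comb_quadratic_le` — the pointwise bound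
  `‖(g ⋆ g̃)^(ρ)‖ ≤ (κ/M)² C_α² w(ρ) ‖ζ_M(ρ)‖ ‖ζ_M(1-ρ)‖` with
  `w(ρ) = ‖b̂₁(1/2 + (ρ-1/2)κ/M)‖ ‖b̂₁(1/2 + (1/2-ρ̄)κ/M)‖`, `C_α = ∑ |α_ℓ| √ℓ`;
* `Literature.NumberTheory.LFunctions.exists_norm_weilZeroSidePartial_comb_le` — **every truncated
  zero side of `g ⋆ g̃` is bounded by**
  `C C_α² (κ/M)² (‖b₁‖₁'² M + ‖b₁^{(n)}‖₁'² κ^{-2n} (1 + log M)³ M)` (`n ≥ 3`; `‖·‖₁'` the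
  weighted `L¹` norm `weilL1`), uniformly in the truncation height.

The point: against `‖g‖₂² ≍ (κ/M) log M`, the right side is `o(‖g‖₂²)` when `κ = (log M)^θ`,
`0 < θ < 1` and `n` is large — `ζ`-mollified combs are asymptotically Weil-neutral.

## References

* E. Bombieri, *Remarks on Weil's quadratic functional in the theory of prime numbers I* (2000), §3.
* E. C. Titchmarsh, *The Theory of the Riemann Zeta-Function*, 2nd ed. (1986), Theorem 4.11.
-/

noncomputable section

open Complex Set Filter Finset
open scoped Real Topology ComplexConjugate

namespace Literature.NumberTheory.LFunctions

/-- The mollified coefficient at `m = 0` vanishes (`divisors 0 = ∅`). [folklore] -/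
theorem divisorConv_zero (α : ℕ → ℝ) (M : ℕ) :
    (∑ k ∈ (Nat.divisors 0).filter (· ≤ M), α (0 / k) / Real.sqrt k : ℝ) = 0 := by
  simp

/-- **Pointwise bound at a zero for the `ζ`-mollified comb.** For `1 ≤ κ ≤ M` and a non-trivial
zero `ρ`, with `g(u) = ∑_{m ≤ LM} a_m b₁((u - log m) M/κ)` and `λ = M/κ`:
`‖(g ⋆ g̃)^(ρ)‖ ≤ (κ/M)² C_α² (‖b̂₁(1/2 + (ρ-1/2)/λ)‖ ‖b̂₁(1/2 + (1/2-ρ̄)/λ)‖)`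
`· ‖ζ_M(ρ)‖ ‖ζ_M(1-ρ)‖`, `C_α = ∑_{ℓ ≤ L} |α_ℓ| √ℓ`. [cite: Bombieri2000, §3] -/
theorem norm_weilMellin_comb_quadratic_le {α : ℕ → ℝ} {L : ℕ} (hα : ∀ m, L < m → α m = 0)
    {b₁ : ℝ → ℂ} (hb : IsWeilTest b₁) {M : ℕ} {κ : ℝ} (hκ1 : 1 ≤ κ) (hκM : κ ≤ M) {ρ : ℂ}
    (hρ : ρ ∈ ZetaZeros.riemannZetaNontrivialZeros) :
    ‖weilMellin (weilConv
        (fun u ↦ ∑ m ∈ Finset.range (L * M + 1),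
          ((∑ k ∈ (Nat.divisors m).filter (· ≤ M), α (m / k) / Real.sqrt k : ℝ) : ℂ) *
            b₁ ((u - Real.log m) * ((M : ℝ) / κ)))
        (weilReflect (fun u ↦ ∑ m ∈ Finset.range (L * M + 1),
          ((∑ k ∈ (Nat.divisors m).filter (· ≤ M), α (m / k) / Real.sqrt k : ℝ) : ℂ) *
            b₁ ((u - Real.log m) * ((M : ℝ) / κ))))) ρ‖
      ≤ (κ / M) ^ 2 * (∑ ℓ ∈ Finset.Icc 1 L, |α ℓ| * Real.sqrt ℓ) ^ 2 *
        (‖weilMellin b₁ (1 / 2 + (ρ - 1 / 2) / (((M : ℝ) / κ : ℝ) : ℂ))‖ *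
          ‖weilMellin b₁ (1 / 2 + (1 / 2 - conj ρ) / (((M : ℝ) / κ : ℝ) : ℂ))‖) *
        (‖∑ k ∈ Finset.Icc 1 M, (k : ℂ) ^ (-ρ)‖ * ‖∑ k ∈ Finset.Icc 1 M, (k : ℂ) ^ (-(1 - ρ))‖) := by
  have hM0 : (0 : ℝ) < M := by linarith
  have hκ0 : 0 < κ := by linarith
  set lam : ℝ := (M : ℝ) / κ with hlam
  have hlam0 : 0 < lam := div_pos hM0 hκ0
  set c : ℕ → ℂ := fun m ↦ ((∑ k ∈ (Nat.divisors m).filter (· ≤ M), α (m / k) / Real.sqrt k : ℝ) : ℂ)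
    with hc
  have hc0 : c 0 = 0 := by simp [hc]
  set g : ℝ → ℂ := fun u ↦ ∑ m ∈ Finset.range (L * M + 1), c m * b₁ ((u - Real.log m) * lam)
    with hg
  have hgt : IsWeilTest g := isWeilTest_logComb hb c _ hlam0.ne'
  change ‖weilMellin (weilConv g (weilReflect g)) ρ‖ ≤ _
  rw [weilMellin_weilQuadratic hgt, norm_mul, Complex.norm_conj]
  -- the two transforms
  have h1 := norm_weilMellin_logComb_le hb hc0 (L * M + 1) hlam0 ρ
  have h2 := norm_weilMellin_logComb_le hb hc0 (L * M + 1) hlam0 (1 - conj ρ)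
  have hre1 : ρ.re ≤ 1 := (ZetaZeros.riemannZetaNontrivialZeros.re_lt_one hρ).le
  have hre2 : (1 - conj ρ).re ≤ 1 := by
    simp only [sub_re, one_re, conj_re]
    linarith [ZetaZeros.riemannZetaNontrivialZeros.re_pos hρ]
  have hA1 := norm_sum_divisorConv_mul_cpow_le hα M hre1
  have hA2 := norm_sum_divisorConv_mul_cpow_le hα M hre2
  have hconj : ‖∑ k ∈ Finset.Icc 1 M, (k : ℂ) ^ (-(1 - (1 - conj ρ)))‖
      = ‖∑ k ∈ Finset.Icc 1 M, (k : ℂ) ^ (-ρ)‖ := by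
    rw [show (1 : ℂ) - (1 - conj ρ) = conj ρ by ring, sum_Icc_cpow_neg_conj, Complex.norm_conj]
  rw [hconj] at hA2
  have harg : (1 : ℂ) - conj ρ - 1 / 2 = 1 / 2 - conj ρ := by ring
  rw [harg] at h2 hA2
  have hlaminv : lam⁻¹ = κ / M := by rw [hlam, inv_div]
  rw [hlaminv] at h1 h2
  set Cα : ℝ := ∑ ℓ ∈ Finset.Icc 1 L, |α ℓ| * Real.sqrt ℓ with hCα
  have hCα0 : 0 ≤ Cα := Finset.sum_nonneg fun ℓ _ ↦ by positivity
  set B1 : ℝ := ‖weilMellin b₁ (1 / 2 + (ρ - 1 / 2) / lam)‖ with hB1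
  set B2 : ℝ := ‖weilMellin b₁ (1 / 2 + (1 / 2 - conj ρ) / lam)‖ with hB2
  set Z1 : ℝ := ‖∑ k ∈ Finset.Icc 1 M, (k : ℂ) ^ (-ρ)‖ with hZ1
  set Z2 : ℝ := ‖∑ k ∈ Finset.Icc 1 M, (k : ℂ) ^ (-(1 - ρ))‖ with hZ2
  have hg1 : ‖weilMellin g ρ‖ ≤ κ / M * B1 * (Cα * Z2) :=
    h1.trans (mul_le_mul_of_nonneg_left hA1 (by positivity))
  have hg2 : ‖weilMellin g (1 - conj ρ)‖ ≤ κ / M * B2 * (Cα * Z1) :=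
    h2.trans (mul_le_mul_of_nonneg_left hA2 (by positivity))
  have hfin : ‖weilMellin g ρ‖ * ‖weilMellin g (1 - conj ρ)‖
      ≤ (κ / M * B1 * (Cα * Z2)) * (κ / M * B2 * (Cα * Z1)) :=
    mul_le_mul hg1 hg2 (norm_nonneg _) (by positivity)
  refine hfin.trans (le_of_eq ?_)
  ring

/-- The weight at a zero: the trivial bound `‖b̂₁(1/2 + z)‖ ≤ ∫ ‖b₁‖ e^{|t|/2}` applies to both
factors (`|Re z| ≤ 1/2` since `λ = M/κ ≥ 1`). [folklore] -/
theorem comb_weight_le_weilL1_sq {b₁ : ℝ → ℂ} (hb : IsWeilTest b₁) {M : ℕ} {κ : ℝ}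
    (hκ1 : 1 ≤ κ) (hκM : κ ≤ M) {ρ : ℂ} (hρ : ρ ∈ ZetaZeros.riemannZetaNontrivialZeros) :
    ‖weilMellin b₁ (1 / 2 + (ρ - 1 / 2) / (((M : ℝ) / κ : ℝ) : ℂ))‖ *
        ‖weilMellin b₁ (1 / 2 + (1 / 2 - conj ρ) / (((M : ℝ) / κ : ℝ) : ℂ))‖ ≤ weilL1 b₁ ^ 2 := by
  have hM0 : (0 : ℝ) < M := by linarith
  have hκ0 : 0 < κ := by linarith
  have hlam0 : 0 < (M : ℝ) / κ := div_pos hM0 hκ0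
  have hlam1 : 1 ≤ (M : ℝ) / κ := by rw [le_div_iff₀ hκ0]; linarith
  have hβ0 := ZetaZeros.riemannZetaNontrivialZeros.re_pos hρ
  have hβ1 := ZetaZeros.riemannZetaNontrivialZeros.re_lt_one hρ
  have hre : ∀ x : ℝ, |x| ≤ 1 / 2 → |x / ((M : ℝ) / κ)| ≤ 1 / 2 := by
    intro x hx
    rw [abs_div, abs_of_pos hlam0]
    calc |x| / ((M : ℝ) / κ) ≤ |x| / 1 := div_le_div_of_nonneg_left (abs_nonneg _) one_pos hlam1
      _ ≤ 1 / 2 := by simpa using hx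
  have h1 : |((ρ - 1 / 2) / (((M : ℝ) / κ : ℝ) : ℂ)).re| ≤ 1 / 2 := by
    rw [Complex.div_ofReal_re]
    refine hre _ (abs_le.2 ⟨?_, ?_⟩) <;> simp <;> linarith
  have h2 : |((1 / 2 - conj ρ) / (((M : ℝ) / κ : ℝ) : ℂ)).re| ≤ 1 / 2 := by
    rw [Complex.div_ofReal_re]
    refine hre _ (abs_le.2 ⟨?_, ?_⟩) <;> simp <;> linarith
  have hb1 := norm_weilMellin_half_add_le_weilL1 hb h1
  have hb2 := norm_weilMellin_half_add_le_weilL1 hb h2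
  rw [sq]
  exact mul_le_mul hb1 hb2 (norm_nonneg _) (weilL1_nonneg _)

/-- The weight at a zero of large height decays: for `n ≥ 3` and `2^j M < |Im ρ|`,
`w(ρ) ≤ (∫ ‖b₁^{(n)}‖ e^{|t|/2})² κ^{-2n} / 64^j` (`n` integrations by parts in each factor).
[folklore] -/
theorem comb_weight_le_of_height {b₁ : ℝ → ℂ} (hb : IsWeilTest b₁) {n : ℕ} (hn : 3 ≤ n) {M : ℕ}
    {κ : ℝ} (hκ1 : 1 ≤ κ) (hκM : κ ≤ M) {ρ : ℂ} (hρ : ρ ∈ ZetaZeros.riemannZetaNontrivialZeros)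
    {j : ℕ} (hj : (2 : ℝ) ^ j * M < |ρ.im|) :
    ‖weilMellin b₁ (1 / 2 + (ρ - 1 / 2) / (((M : ℝ) / κ : ℝ) : ℂ))‖ *
        ‖weilMellin b₁ (1 / 2 + (1 / 2 - conj ρ) / (((M : ℝ) / κ : ℝ) : ℂ))‖
      ≤ weilL1 (deriv^[n] b₁) ^ 2 / κ ^ (2 * n) / 64 ^ j := by
  have hM0 : (0 : ℝ) < M := by linarith
  have hκ0 : 0 < κ := by linarith
  set lam : ℝ := (M : ℝ) / κ with hlam
  have hlam0 : 0 < lam := div_pos hM0 hκ0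
  have hlam1 : 1 ≤ lam := by rw [hlam, le_div_iff₀ hκ0]; linarith
  have hβ0 := ZetaZeros.riemannZetaNontrivialZeros.re_pos hρ
  have hβ1 := ZetaZeros.riemannZetaNontrivialZeros.re_lt_one hρ
  have hγ0 : 0 < |ρ.im| := lt_of_le_of_lt (by positivity) hj
  set D : ℝ := weilL1 (deriv^[n] b₁) with hD
  have hD0 : 0 ≤ D := weilL1_nonneg _
  have hre : ∀ x : ℝ, |x| ≤ 1 / 2 → |x / lam| ≤ 1 / 2 := by
    intro x hx
    rw [abs_div, abs_of_pos hlam0]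
    calc |x| / lam ≤ |x| / 1 := div_le_div_of_nonneg_left (abs_nonneg _) one_pos hlam1
      _ ≤ 1 / 2 := by simpa using hx
  have key : ∀ z : ℂ, |z.re| ≤ 1 / 2 → |z.im| = |ρ.im| →
      ‖weilMellin b₁ (1 / 2 + z / lam)‖ ≤ D / κ ^ n / (2 ^ n) ^ j := by
    intro z hzre hzim
    have hz1 : |(z / (lam : ℂ)).re| ≤ 1 / 2 := by rw [Complex.div_ofReal_re]; exact hre _ hzre
    have hz2 : (z / (lam : ℂ)).im ≠ 0 := by
      rw [Complex.div_ofReal_im]; exact div_ne_zero (abs_pos.1 (hzim ▸ hγ0)) hlam0.ne'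
    have h := norm_weilMellin_half_add_le hb n hz1 hz2
    rw [Complex.div_ofReal_im, abs_div, abs_of_pos hlam0, hzim] at h
    refine h.trans ?_
    have hq : (2 : ℝ) ^ j * κ ≤ |ρ.im| / lam := by
      rw [le_div_iff₀ hlam0, hlam]
      calc (2 : ℝ) ^ j * κ * (M / κ) = 2 ^ j * M := by field_simp
        _ ≤ |ρ.im| := hj.le
    have hqpos : 0 < (2 : ℝ) ^ j * κ := by positivity
    calc D / (|ρ.im| / lam) ^ n ≤ D / ((2 : ℝ) ^ j * κ) ^ n :=
          div_le_div_of_nonneg_left hD0 (pow_pos hqpos n) (pow_le_pow_left₀ hqpos.le hq n)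
      _ = D / κ ^ n / (2 ^ n) ^ j := by
          rw [mul_pow, ← pow_mul, ← pow_mul, mul_comm j n]; field_simp
  have h1 := key (ρ - 1 / 2) (abs_le.2 ⟨by simp; linarith, by simp; linarith⟩) (by simp)
  have h2 := key (1 / 2 - conj ρ) (abs_le.2 ⟨by simp; linarith, by simp; linarith⟩) (by simp)
  have hbd : 0 ≤ D / κ ^ n / (2 ^ n) ^ j := by positivity
  calc ‖weilMellin b₁ (1 / 2 + (ρ - 1 / 2) / lam)‖ *
        ‖weilMellin b₁ (1 / 2 + (1 / 2 - conj ρ) / lam)‖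
      ≤ (D / κ ^ n / (2 ^ n) ^ j) * (D / κ ^ n / (2 ^ n) ^ j) :=
        mul_le_mul h1 h2 (norm_nonneg _) hbd
    _ = D ^ 2 / κ ^ (2 * n) / ((2 ^ n) ^ j) ^ 2 := by
        rw [pow_mul]; field_simp; ring
    _ ≤ D ^ 2 / κ ^ (2 * n) / 64 ^ j := by
        refine div_le_div_of_nonneg_left (by positivity) (by positivity) ?_
        calc (64 : ℝ) ^ j = 2 ^ (6 * j) := by rw [pow_mul]; norm_num
          _ ≤ 2 ^ (2 * n * j) := pow_le_pow_right₀ (by norm_num) (by nlinarith)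
          _ = ((2 ^ n) ^ j) ^ 2 := by rw [← pow_mul, ← pow_mul]; congr 1; ring

/-- **The zero side of the explicit formula for `ζ`-mollified resonator combs.** There is an
absolute constant `C` such that for every real resonator `α` supported on `[1, L]`, every Weil
test function `b₁`, every `n ≥ 3`, and all `M`, `κ` with `1 ≤ κ ≤ M`, the comb
`g(u) = ∑_{m ≤ LM} (∑_{k ∣ m, k ≤ M} α(m/k)/√k) b₁((u - log m) M/κ)` satisfies, for every
truncation height `T`,
`‖∑_{|Im ρ| ≤ T} m(ρ) (g ⋆ g̃)^(ρ)‖`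
`≤ C (∑_{ℓ≤L} |α_ℓ|√ℓ)² (κ/M)² ((∫‖b₁‖e^{|t|/2})² M + (∫‖b₁^{(n)}‖e^{|t|/2})² κ^{-2n} (1 + log M)³ M)`.
[cite: Bombieri2000, §3] -/
theorem exists_norm_weilZeroSidePartial_comb_le :
    ∃ C : ℝ, 0 < C ∧ ∀ (α : ℕ → ℝ) (L : ℕ), (∀ m, L < m → α m = 0) →
      ∀ (b₁ : ℝ → ℂ), IsWeilTest b₁ → ∀ (n : ℕ), 3 ≤ n →
      ∀ (M : ℕ) (κ : ℝ), 1 ≤ κ → κ ≤ M →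
        let g : ℝ → ℂ := fun u ↦ ∑ m ∈ Finset.range (L * M + 1),
          ((∑ k ∈ (Nat.divisors m).filter (· ≤ M), α (m / k) / Real.sqrt k : ℝ) : ℂ) *
            b₁ ((u - Real.log m) * ((M : ℝ) / κ))
        ∀ T : ℝ, ‖weilZeroSidePartial (weilConv g (weilReflect g)) T‖
          ≤ C * (∑ ℓ ∈ Finset.Icc 1 L, |α ℓ| * Real.sqrt ℓ) ^ 2 * (κ / M) ^ 2 *
            (weilL1 b₁ ^ 2 * M
              + weilL1 (deriv^[n] b₁) ^ 2 / κ ^ (2 * n) * (1 + Real.log M) ^ 3 * M) := by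
  obtain ⟨C, hC, htot⟩ := exists_sum_weighted_norm_zetaPartialSum_mul_le
  refine ⟨C, hC, ?_⟩
  intro α L hα b₁ hb n hn M κ hκ1 hκM g T
  have hM1 : 1 ≤ M := by
    have : (1 : ℝ) ≤ M := hκ1.trans hκM
    exact_mod_cast this
  have hM0 : (0 : ℝ) < M := by exact_mod_cast hM1
  have hκ0 : 0 < κ := by linarith
  set lam : ℝ := (M : ℝ) / κ with hlam
  set Cα : ℝ := ∑ ℓ ∈ Finset.Icc 1 L, |α ℓ| * Real.sqrt ℓ with hCα
  have hCα0 : 0 ≤ Cα := Finset.sum_nonneg fun ℓ _ ↦ by positivity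
  -- the weight and its two bounds
  set w : ZetaZeros.riemannZetaNontrivialZeros → ℝ := fun ρ ↦
    ‖weilMellin b₁ (1 / 2 + ((ρ : ℂ) - 1 / 2) / (lam : ℂ))‖ *
      ‖weilMellin b₁ (1 / 2 + (1 / 2 - conj (ρ : ℂ)) / (lam : ℂ))‖ with hw
  have hw0 : ∀ ρ, 0 ≤ w ρ := fun ρ ↦ by positivity
  have hwlow : ∀ ρ : ZetaZeros.riemannZetaNontrivialZeros, |(ρ : ℂ).im| ≤ M →
      w ρ ≤ weilL1 b₁ ^ 2 := fun ρ _ ↦ comb_weight_le_weilL1_sq hb hκ1 hκM ρ.2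
  have hwhigh : ∀ (j : ℕ) (ρ : ZetaZeros.riemannZetaNontrivialZeros),
      (2 : ℝ) ^ j * M < |(ρ : ℂ).im| → |(ρ : ℂ).im| ≤ (2 : ℝ) ^ (j + 1) * M →
      w ρ ≤ weilL1 (deriv^[n] b₁) ^ 2 / κ ^ (2 * n) / 64 ^ j :=
    fun j ρ hj _ ↦ comb_weight_le_of_height hb hn hκ1 hκM ρ.2 hj
  have hsum := htot M hM1 (weilL1 b₁ ^ 2) (weilL1 (deriv^[n] b₁) ^ 2 / κ ^ (2 * n))
    (by positivity) (by positivity) w hw0 hwlow hwhigh (weilZeroFinset T)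
  -- pointwise
  have hpt : ∀ ρ ∈ weilZeroFinset T,
      ‖(riemannZetaZeroOrder (ρ : ℂ) : ℂ) * weilMellin (weilConv g (weilReflect g)) ρ‖
        ≤ (κ / M) ^ 2 * Cα ^ 2 * ((riemannZetaZeroOrder (ρ : ℂ) : ℝ) * (w ρ *
          (‖∑ k ∈ Finset.Icc 1 M, (k : ℂ) ^ (-(ρ : ℂ))‖ *
            ‖∑ k ∈ Finset.Icc 1 M, (k : ℂ) ^ (-(1 - (ρ : ℂ)))‖))) := by
    intro ρ _
    have hm : (0 : ℝ) ≤ riemannZetaZeroOrder (ρ : ℂ) := by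
      exact_mod_cast zero_le_one.trans (ZetaZeros.riemannZetaNontrivialZeros.one_le_order ρ.2)
    have hnm : ‖(riemannZetaZeroOrder (ρ : ℂ) : ℂ)‖ = (riemannZetaZeroOrder (ρ : ℂ) : ℝ) := by
      rw [Complex.norm_intCast, abs_of_nonneg hm]
    rw [norm_mul, hnm]
    have h := norm_weilMellin_comb_quadratic_le hα hb hκ1 hκM ρ.2
    have h' := mul_le_mul_of_nonneg_left h hm
    refine h'.trans (le_of_eq ?_)
    simp only [hw, hCα, hlam]
    ring
  calc ‖weilZeroSidePartial (weilConv g (weilReflect g)) T‖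
      = ‖∑ ρ ∈ weilZeroFinset T,
          (riemannZetaZeroOrder (ρ : ℂ) : ℂ) * weilMellin (weilConv g (weilReflect g)) ρ‖ := by
        rw [weilZeroSidePartial_eq_sum]
    _ ≤ ∑ ρ ∈ weilZeroFinset T,
          ‖(riemannZetaZeroOrder (ρ : ℂ) : ℂ) * weilMellin (weilConv g (weilReflect g)) ρ‖ :=
        norm_sum_le _ _
    _ ≤ ∑ ρ ∈ weilZeroFinset T, (κ / M) ^ 2 * Cα ^ 2 * ((riemannZetaZeroOrder (ρ : ℂ) : ℝ) * (w ρ *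
          (‖∑ k ∈ Finset.Icc 1 M, (k : ℂ) ^ (-(ρ : ℂ))‖ *
            ‖∑ k ∈ Finset.Icc 1 M, (k : ℂ) ^ (-(1 - (ρ : ℂ)))‖))) := Finset.sum_le_sum hpt
    _ = (κ / M) ^ 2 * Cα ^ 2 * ∑ ρ ∈ weilZeroFinset T, (riemannZetaZeroOrder (ρ : ℂ) : ℝ) * (w ρ *
          (‖∑ k ∈ Finset.Icc 1 M, (k : ℂ) ^ (-(ρ : ℂ))‖ *
            ‖∑ k ∈ Finset.Icc 1 M, (k : ℂ) ^ (-(1 - (ρ : ℂ)))‖)) := by rw [Finset.mul_sum]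
    _ ≤ (κ / M) ^ 2 * Cα ^ 2 * (C * (weilL1 b₁ ^ 2 * M
          + weilL1 (deriv^[n] b₁) ^ 2 / κ ^ (2 * n) * (1 + Real.log M) ^ 3 * M)) :=
        mul_le_mul_of_nonneg_left hsum (by positivity)
    _ = C * Cα ^ 2 * (κ / M) ^ 2 * (weilL1 b₁ ^ 2 * M
          + weilL1 (deriv^[n] b₁) ^ 2 / κ ^ (2 * n) * (1 + Real.log M) ^ 3 * M) := by ring

end Literature.NumberTheory.LFunctions
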